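import Literature.MathematicalPhysics.QuantumFieldTheory.Balaban1983to89.B3Ineq25Op116RegularRegion

/-!
# Bałaban, *(Higgs)₂,₃ quantum fields in a finite volume III. Renormalization* [B3] — inequality (2.5) p. 424, the (1.16) alternative, IN
PRINT'S LITERAL CURRENCY «uniformly bounded by `O(1)(e(L^kε)^{1−α′})^{n+n′}`, where `α′ > 0` but can be arbitrarily small» (p. 414):
the logarithm `p(L^kε)` absorbed into an arbitrarily small power of the running coupling `e(L^kε)`, uniformly in the scale `k`

statement-level skeleton of published theorems with citation tags; proofs where landed; nothing here is a claim about the Yang–Mills mass gap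

T. Bałaban, Commun. Math. Phys. **88** (1983) 411–445 [cite: Balaban1983Higgs3]; part I, Commun. Math. Phys. **85** (1982) 603–636
[cite: Balaban1982Higgs1].  PDFs held: `paper:balaban1983-higgs-2-3-quantum-fields-finite-volume` (journal page = PDF page + 410; p. 412 =
`p0002.txt`, p. 414 = `p0004.txt`, p. 424 = `p0014.txt`), `paper:balaban1982-cmp85-higgs23-i` (journal page = PDF page + 602; p. 613 =
`p0011.txt`, p. 614 = `p0012.txt`).

CITATION HEADER (lean-in-tree rule).  Cell `lit-balaban` (HOME `run/shared/lean/pub/lit-balaban/`), Phase-2 proof seat **p40** gen 75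
(unit `lit-balaban-p40`); TAKING line HOME/STATUS 2026-08-23T11:26Z = owner r15 g15's CONDITION (λ) of lead g12's Q27 word (11:16Z): «one
kernel corollary putting the (1.16) kernel/norm bounds in print's LITERAL currency O(1)(e(L^kε)^{1−α′})^{n+n′}, α′ > 0 arbitrarily small,
composed with R5 `ineq25At_op116_region` (and/or the torus p358683)».  SKELETON rows **B3.Eq1.16** / **B3.Eq2.5** (decl of record
`B3Sect2StatementsPart2.ScaledKernels.Ineq25At`), fold owner r15 — a located member.  USED BY NAME, never restated: p40 g75's R5
`B3Ineq25Op116RegularRegion.ineq25At_op116_region` (the hypothesis-free region member at carrier parameters `(e_R, p_R)`), p40 g72's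
`B3Ineq25Op116Smooth.{sect2Smooth116, ineq25At_smooth116_iff}`, r14's `interior_univ`, the steward's `isBigBlockUnion_univ`, R1's `DeepBlk`.

## What is printed (verbatim)

[B3] p. 414 [PDF 4]: *"More exactly the Hölder norms of the covariant derivatives of this kernel, the norms defined for example in the
inequalities (I.2.24) and (I.2.25) of Proposition I.2.1, are exponentially decaying with the distance of the arguments and are uniformly
bounded by O(1)(e(L^kε)^{1−α})^{n+n′}, where α > 0 but can be arbitrarily small."*  [B3] p. 424 (2.5): *"‖h(an operator δG_k(Ω,Ω₂,B̃) or
(1.16))h′‖_{1,α} ≤ O(e^{−δ₀dist(Ω₂,∂Ω)} or (e(L^kε)p(L^kε))^{n+n′})e^{−δ₀dist(supp h, supp h′)}"*.  [B3] p. 412 [PDF 2]: *"we will assume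
that |A|, |∂A|, |∂B| and their Hölder norms with exponent α₀ are ≤ O(1)p(L^kε) and dist(supp A, ∂Ω) > 2r(L^kε)"*.  [B1] p. 614 [PDF 12],
(3.14): *"U(A) = exp(ηqe(L^kε)A) … where e(L^kε) = e(L^kε)^{(4−d)/2}"* (the running coupling: `e` times the power `κ = (4−d)/2 > 0` of the
length `L^kε`); (3.12): *"p₁(ε) = b₁(1 + log ε^{−1})^{p₁}"* (the shape of the logarithmic functions `p(·)` of the small-field conditions).

## What this file proves, and how

§1 the elementary absorption of a logarithm into a small power, uniformly: `(1 + t)^q e^{−at} ≤ max(1, q/a)^q` for `t ≥ 0`, `a > 0`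
(`one_add_pow_mul_exp_neg_le`), hence for `0 < δ ≤ 1`, `κ, α′ > 0`, `b₀ ≥ 0`:
`(|e|δ^κ)^{α′}·b₀(1 + log δ^{−1})^q ≤ K := |e|^{α′}b₀·max(1, q/(κα′))^q` (`runCoupling_rpow_mul_log_le`) — `K = K(α′, κ, q, e, b₀)` does NOT
depend on `δ = L^kε`, i.e. not on `k`.  §2 the carrier-level conversion (`ineq25At_smooth116_currency`): the two clauses of r15's `Ineq25At`
on p40's carrier `sect2Smooth116 … e_R p_R` do not see the running constants except through the factor `(e_Rp_R)^{n+n′}`, so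
`Ineq25At n n′ α δ C` at `(e_R, p_R)` with `e_R^{α′}p_R ≤ K`, `K ≥ 1`, gives `Ineq25At n n′ α δ (C·K^{n+n′})` at `(e_R^{1−α′}, 1)` — right side
`C·K^{n+n′}·(e_R^{1−α′})^{n+n′}·e^{−δ dist(supp h, supp h′)}`, print's currency.  §3 the composed members: **`ineq25At_op116_region_printCurrency`**
= R5's hypothesis-free region theorem `ineq25At_op116_region` (nested big-block unions `Ω₂ ⊆ Ω`, print's p. 412 support clause) at the printed
running constants `e_R = |e|(L^kε)^κ`, `p_R = b₀(1 + log (L^kε)^{−1})^q`, converted by §2 with §1's `K`: conclusion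
`(sect2Smooth116 hP1 C Ω Ω₂ A B … ((|e|(L^kε)^κ)^{1−α′}) 1).Ineq25At n n′ α (min δ₀ (δ₁/(4L)^{n+n′+1})) (C_{R5}·K₊^{n+n′})`, `K₊ = max(1,K)`, for
every `0 < α′ < 1`; R5's carrier reading «`L^kε ≤ e_Rp_R`» is DISCHARGED inside from `κ ≤ 1`, `|e|b₀ ≥ 1`, `L^kε ≤ 1`
(`mesh_le_runCoupling_mul_log`); **`ineq25At_op116_torus_printCurrency`** = the case `Ω = T_ε` (every site deep: the support clause is void).

## Honest scope / declared divergences (F7)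

(i) The NEW constant is only `K₊^{n+n′}`, `K₊ = max(1, |e|^{α′}b₀max(1,q/(κα′))^q)`, uniform in `k`, the volume and the position; the factor
`C_{R5} = C_G + K(c₁,c₂+2c₁,d,m)(valC(n+n′)+derC(n+n′)) + holC(n+n′−1) + d·m·mixC(n+n′)` is R5's explicit constant VERBATIM — R5's declared
divergence (ii) stands: the coupling powers `(|e|s + L^k|e|δ_A + …)^{n+n′}` inside p35's `valC/derC/holC` and p40's `mixC` are NOT re-expressed as
powers of `e(L^kε)p(L^kε)`; this file converts the CARRIER currency `(e_Rp_R)^{n+n′} ↦ (e_R^{1−α′})^{n+n′}` exactly as print's sentence does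
(«α′ > 0 arbitrarily small» = the logarithm costs an arbitrarily small power of the coupling), nothing more.  (ii) The running constants are
print's shapes with free parameters: `e(δ) = |e|δ^κ`, any `0 < κ ≤ 1` (print: `κ = (4−d)/2`, `d = 2, 3`), `p(δ) = b₀(1 + log δ^{−1})^q`, any
`q ∈ ℕ`, `b₀ ≥ 0` with `|e|b₀ ≥ 1` (print's `b₀` «sufficiently large»; this is what makes R5's reading `L^kε ≤ e_Rp_R` hold for `L^kε ≤ 1`).
(iii) Everything else — regime, thresholds, `n, n′ ≥ 1`, `n + n′ > d`, `0 ≤ α < 1` (the Hölder index of the norm, distinct from the currency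
exponent `α′`) — as in R5 (regions) / p358683 (torus).  No `def`, no new named fact, no `sorry`; axioms standard.  Value = the located
currency sentence of p. 414 on top of the assembled (2.5) members — NOT summit progress and nothing about the Yang–Mills mass gap.
-/

noncomputable section

open scoped BigOperators

namespace Literature.MathematicalPhysics.QuantumFieldTheory.Balaban1983to89.B3Ineq25Op116PrintCurrency

open HiggsLattice (ChargeData)
open B1Eq230FluctCov (Ix)
open B1TorusCubeCover (half)
open B1TorusRegionHSizes (IsBigBlockUnion isBigBlockUnion_univ)
open B3Ineq210RegularRegion (Interior interior_univ)
open B3Ineq31SmoothLocalization (smoothConst)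
open B3Ineq25Op116Smooth (sect2Smooth116 ineq25At_smooth116_iff)
open B3Op116DKernelRegularTorus (valC derC)
open B3Op116HolderKernelRegularTorus (holC)
open B3Op116MixedKernelRegularTorus (mixC)
open B3Op116RegionSources (DeepBlk)
open B3Ineq25Op116RegularRegion (ineq25At_op116_region)

variable {P : HiggsLattice.Params} {N : ℕ}

/-! ## §1 A logarithm costs an arbitrarily small power, uniformly -/

section Elementary

/-- `(1 + t)·e^{−ct} ≤ max(1, c^{−1})` for `t ≥ 0`, `c > 0` (`e^{ct} ≥ 1 + ct`). [cite: Balaban1983Higgs3, p.414] -/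
theorem one_add_mul_exp_neg_le {c t : ℝ} (hc : 0 < c) (ht : 0 ≤ t) : (1 + t) * Real.exp (-(c * t)) ≤ max 1 c⁻¹ := by
  set m : ℝ := max 1 c⁻¹ with hm
  have hm1 : 1 ≤ m := le_max_left _ _
  have hmc : 1 ≤ m * c := by
    have : c⁻¹ ≤ m := le_max_right _ _
    calc (1 : ℝ) = c⁻¹ * c := by rw [inv_mul_cancel₀ hc.ne']
      _ ≤ m * c := mul_le_mul_of_nonneg_right this hc.le
  have h1 : 1 + t ≤ m * (1 + c * t) := by nlinarith
  have h2 : 1 + c * t ≤ Real.exp (c * t) := by have := Real.add_one_le_exp (c * t); linarith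
  have hE : 0 < Real.exp (-(c * t)) := Real.exp_pos _
  calc (1 + t) * Real.exp (-(c * t)) ≤ m * (1 + c * t) * Real.exp (-(c * t)) := mul_le_mul_of_nonneg_right h1 hE.le
    _ ≤ m * Real.exp (c * t) * Real.exp (-(c * t)) :=
        mul_le_mul_of_nonneg_right (mul_le_mul_of_nonneg_left h2 (by linarith)) hE.le
    _ = m := by rw [mul_assoc, ← Real.exp_add, add_neg_cancel, Real.exp_zero, mul_one]

/-- **`(1 + t)^q e^{−at} ≤ max(1, q/a)^q`** for `t ≥ 0`, `a > 0`, `q ∈ ℕ`: a power of a logarithm (`t = log δ^{−1}`) is absorbed by any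
positive power `δ^a = e^{−at}`, with a constant independent of `t`. [cite: Balaban1983Higgs3, p.414] -/
theorem one_add_pow_mul_exp_neg_le {a t : ℝ} (ha : 0 < a) (ht : 0 ≤ t) (q : ℕ) :
    (1 + t) ^ q * Real.exp (-(a * t)) ≤ max 1 ((q : ℝ) / a) ^ q := by
  rcases Nat.eq_zero_or_pos q with rfl | hq
  · simp only [pow_zero, one_mul]
    exact Real.exp_le_one_iff.mpr (by nlinarith)
  · have hq' : (0 : ℝ) < q := by exact_mod_cast hq
    set c : ℝ := a / q with hc
    have hc0 : 0 < c := div_pos ha hq'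
    have hac : a * t = (q : ℝ) * (c * t) := by rw [hc]; field_simp
    have hci : c⁻¹ = (q : ℝ) / a := by rw [hc, inv_div]
    rw [hac, show -((q : ℝ) * (c * t)) = (q : ℝ) * (-(c * t)) by ring, Real.exp_nat_mul, ← mul_pow, ← hci]
    exact pow_le_pow_left₀ (mul_nonneg (by linarith) (Real.exp_pos _).le) (one_add_mul_exp_neg_le hc0 ht) q

/-- **THE RUNNING COUPLING ABSORBS THE LOGARITHM**: for `0 < δ ≤ 1`, `κ > 0`, `α′ > 0`, `b₀ ≥ 0`, `q ∈ ℕ`,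
`(|e|δ^κ)^{α′}·(b₀(1 + log δ^{−1})^q) ≤ |e|^{α′}b₀·max(1, q/(κα′))^q` — print's `e(δ)^{α′}p(δ) ≤ K(α′)` with `e(δ) = eδ^{(4−d)/2}` ([B1] (3.14)),
`p(δ) = b₀(1 + log δ^{−1})^p` ([B1] (3.1), (3.12)), UNIFORMLY IN `δ = L^kε` (hence in `k`). [cite: Balaban1983Higgs3, p.414] [cite: Balaban1982Higgs1, (3.12), (3.14) p.614] -/
theorem runCoupling_rpow_mul_log_le {δ κ α' b₀ e : ℝ} (hδ : 0 < δ) (hδ1 : δ ≤ 1) (hκ : 0 < κ) (hα' : 0 < α') (hb₀ : 0 ≤ b₀) (q : ℕ) :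
    (|e| * δ ^ κ) ^ α' * (b₀ * (1 + Real.log δ⁻¹) ^ q) ≤ |e| ^ α' * b₀ * max 1 ((q : ℝ) / (κ * α')) ^ q := by
  set t : ℝ := Real.log δ⁻¹ with htdef
  have ht : 0 ≤ t := by rw [htdef, Real.log_inv]; have := Real.log_nonpos hδ.le hδ1; linarith
  have hpow : δ ^ (κ * α') = Real.exp (-((κ * α') * t)) := by
    rw [Real.rpow_def_of_pos hδ, htdef, Real.log_inv]; ring_nf
  have h1 : (|e| * δ ^ κ) ^ α' = |e| ^ α' * δ ^ (κ * α') := by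
    rw [Real.mul_rpow (abs_nonneg e) (Real.rpow_nonneg hδ.le κ), Real.rpow_mul hδ.le]
  have hmain := one_add_pow_mul_exp_neg_le (mul_pos hκ hα') ht q
  have hea : 0 ≤ |e| ^ α' * b₀ := mul_nonneg (Real.rpow_nonneg (abs_nonneg e) α') hb₀
  calc (|e| * δ ^ κ) ^ α' * (b₀ * (1 + Real.log δ⁻¹) ^ q)
      = |e| ^ α' * b₀ * ((1 + t) ^ q * Real.exp (-((κ * α') * t))) := by rw [h1, hpow, htdef]; ring
    _ ≤ |e| ^ α' * b₀ * max 1 ((q : ℝ) / (κ * α')) ^ q := mul_le_mul_of_nonneg_left hmain hea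

/-- selling the power `α′` of `x`: `x·y ≤ x^{1−α′}·K` when `x^{α′}·y ≤ K` (`x ≥ 0`, `α′ < 1`). [cite: Balaban1983Higgs3, p.414] -/
theorem mul_le_rpow_mul {x y α' K : ℝ} (hx : 0 ≤ x) (hα'1 : α' < 1) (hK : x ^ α' * y ≤ K) : x * y ≤ x ^ (1 - α') * K := by
  rcases hx.eq_or_lt with rfl | hx0
  · rw [zero_mul, Real.zero_rpow (by linarith), zero_mul]
  · have e1 : x ^ (1 - α') * x ^ α' = x := by
      rw [← Real.rpow_add hx0, show (1 : ℝ) - α' + α' = 1 by ring, Real.rpow_one]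
    calc x * y = (x ^ (1 - α') * x ^ α') * y := by rw [e1]
      _ = x ^ (1 - α') * (x ^ α' * y) := by ring
      _ ≤ x ^ (1 - α') * K := mul_le_mul_of_nonneg_left hK (Real.rpow_nonneg hx _)

/-- **R5's carrier reading `L^kε ≤ e_Rp_R` holds for the printed running constants** when `κ ≤ 1`, `|e|b₀ ≥ 1` and `δ = L^kε ≤ 1`:
`δ ≤ δ^κ ≤ (|e|b₀)·δ^κ·(1 + log δ^{−1})^q`. [cite: Balaban1983Higgs3, (2.5) p.424] [cite: Balaban1982Higgs1, (3.12), (3.14) p.614] -/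
theorem mesh_le_runCoupling_mul_log {δ κ b₀ e : ℝ} (hδ : 0 < δ) (hδ1 : δ ≤ 1) (hκ1 : κ ≤ 1) (hb : 1 ≤ |e| * b₀) (q : ℕ) :
    δ ≤ (|e| * δ ^ κ) * (b₀ * (1 + Real.log δ⁻¹) ^ q) := by
  have ht : 0 ≤ Real.log δ⁻¹ := by rw [Real.log_inv]; have := Real.log_nonpos hδ.le hδ1; linarith
  have hlog : 1 ≤ (1 + Real.log δ⁻¹) ^ q := one_le_pow₀ (by linarith)
  have hκδ : δ ≤ δ ^ κ := by
    have h := Real.rpow_le_rpow_of_exponent_ge hδ hδ1 hκ1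
    rwa [Real.rpow_one] at h
  have hδκ0 : 0 ≤ δ ^ κ := Real.rpow_nonneg hδ.le κ
  calc δ ≤ δ ^ κ := hκδ
    _ = 1 * δ ^ κ * 1 := by ring
    _ ≤ (|e| * b₀) * δ ^ κ * (1 + Real.log δ⁻¹) ^ q :=
        mul_le_mul (mul_le_mul_of_nonneg_right hb hδκ0) hlog zero_le_one (mul_nonneg (zero_le_one.trans hb) hδκ0)
    _ = _ := by ring

end Elementary

/-! ## §2 The carrier-level conversion of the currency of (2.5) -/

section Carrier

variable {k K₀ r₀ m : ℕ} {hL1 : 1 < P.L} {C : ChargeData N} {Ω Ω₂ : Finset (HiggsLattice.Site P 0)} {A B : HiggsLattice.VecField P 0}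
  {msq a : ℝ} {c₁ c₂ : ℝ}

/-- **THE CURRENCY OF (2.5) IS CONVERTIBLE**: the two clauses of `Ineq25At` on the carrier `sect2Smooth116 … e_R p_R` see the running
constants only through the factor `(e_Rp_R)^{n+n′}`; if `e_R^{α′}p_R ≤ K` with `K ≥ 1`, `e_R, p_R ≥ 0`, `α′ < 1`, then
`Ineq25At n n′ α δ C` at `(e_R, p_R)` gives `Ineq25At n n′ α δ (C·K^{n+n′})` at `(e_R^{1−α′}, 1)`: the bound
`‖h(1.16)_{n,n′}h′‖_{1,α} ≤ C·K^{n+n′}·(e_R^{1−α′})^{n+n′}·e^{−δdist(supp h,supp h′)}` of print's sentence p. 414.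
[cite: Balaban1983Higgs3, (2.5) p.424, (1.16) p.414] -/
theorem ineq25At_smooth116_currency {n n' : ℕ} {α δ Cst eR pR α' K : ℝ} (hC : 0 ≤ Cst) (heR : 0 ≤ eR) (hpR : 0 ≤ pR)
    (hα'1 : α' < 1) (hK1 : 1 ≤ K) (hK : eR ^ α' * pR ≤ K)
    (h : (sect2Smooth116 hL1 C Ω Ω₂ A B msq a k K₀ r₀ m c₁ c₂ eR pR).Ineq25At n n' α δ Cst) :
    (sect2Smooth116 hL1 C Ω Ω₂ A B msq a k K₀ r₀ m c₁ c₂ (eR ^ (1 - α')) 1).Ineq25At n n' α δ (Cst * K ^ (n + n')) := by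
  rw [ineq25At_smooth116_iff] at h ⊢
  have hKM : 1 ≤ K ^ (n + n') := one_le_pow₀ hK1
  have hCK : Cst ≤ Cst * K ^ (n + n') := le_mul_of_one_le_right hC hKM
  have hCK0 : 0 ≤ Cst * K ^ (n + n') := hC.trans hCK
  refine ⟨fun f f' => (h.1 f f').trans ?_, fun f f' => (h.2 f f').trans ?_⟩
  · exact mul_le_mul_of_nonneg_right (mul_le_mul_of_nonneg_right hCK (Real.exp_pos _).le) (Real.exp_pos _).le
  · have h1 : eR * pR ≤ eR ^ (1 - α') * 1 * K := by rw [mul_one]; exact mul_le_rpow_mul heR hα'1 hK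
    have h2 : (eR * pR) ^ (n + n') ≤ (eR ^ (1 - α') * 1) ^ (n + n') * K ^ (n + n') := by
      rw [← mul_pow]; exact pow_le_pow_left₀ (mul_nonneg heR hpR) h1 _
    calc Cst * (eR * pR) ^ (n + n') * Real.exp (-(δ * B3Ineq25SmoothLocalization.setDist k f.supp f'.supp))
        ≤ Cst * ((eR ^ (1 - α') * 1) ^ (n + n') * K ^ (n + n')) * Real.exp (-(δ * B3Ineq25SmoothLocalization.setDist k f.supp f'.supp)) :=
          mul_le_mul_of_nonneg_right (mul_le_mul_of_nonneg_left h2 hC) (Real.exp_pos _).le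
      _ = Cst * K ^ (n + n') * (eR ^ (1 - α') * 1) ^ (n + n') * Real.exp (-(δ * B3Ineq25SmoothLocalization.setDist k f.supp f'.supp)) := by
          ring

end Carrier

/-! ## §3 (2.5), the (1.16) alternative, in print's currency `(e(L^kε)^{1−α′})^{n+n′}` — region and torus, hypothesis-free under print's regime -/

section Members

set_option maxHeartbeats 800000 in
/-- **INEQUALITY (2.5) OF [B3], THE (1.16) ALTERNATIVE, ON A REGION, IN PRINT'S LITERAL CURRENCY** (p. 414: *"uniformly bounded by
O(1)(e(L^kε)^{1−α})^{n+n′}, where α > 0 but can be arbitrarily small"*).  For `d ≥ 1`, `L ≥ 2`, `a > 0`, `m² > 0`, a regularity budget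
`c ≥ 0`, support size `m`, bump constants `c₁, c₂ ≥ 0`, the SHAPES of the running constants `e(δ) = |e|δ^κ` (`0 < κ ≤ 1`; print
`κ = (4−d)/2`), `p(δ) = b₀(1 + log δ^{−1})^q` (`b₀ ≥ 0`, `q ∈ ℕ`), a currency exponent `0 < α′ < 1`, and orders `n, n′ ≥ 1` with `n + n′ > d`:
∃ `E₀ > 0` ∀ charge data (`e² ≤ E₀`) ∃ `K₀min` ∀ `0 ≤ α < 1` ∀ `K₀ ≥ K₀min` ∃ `t, δ₁, δ₀, C, C_M, C_H, C_G` such that on every torus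
(`d`, `L`, `K₀ ∣ M`), every scale `1 ≤ k ≤ K` (`≥ 3` cubes per direction, `L^kε ≤ 1`), all nested big-block unions `Ω₂ ⊆ Ω`, all backgrounds in
R5's regime (`B̃`, `Ã+B̃` regular on `Ω` and small, `Ã` small, regular and SUPPORTED ON DEEP BONDS — p. 412) AND `|e|b₀ ≥ 1`, every margin `r₀`:
`(sect2Smooth116 hP1 C Ω Ω₂ A B … ((|e|(L^kε)^κ)^{1−α′}) 1).Ineq25At n n′ α (min δ₀ (δ₁/(4L)^{n+n′+1})) (C_{R5}·K₊^{n+n′})`, i.e.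
`‖h(1.16)^Ω_{n,n′}h′‖_{1,α} ≤ C_{R5}K₊^{n+n′}·(e(L^kε)^{1−α′})^{n+n′}·e^{−δdist(supp h,supp h′)}` (and the `δG_k` clause), with
`K₊ = max(1, |e|^{α′}b₀max(1,q/(κα′))^q)` INDEPENDENT OF `k` and `C_{R5}` R5's explicit constant.  R5's `ineq25At_op116_region` at
`(e_R, p_R) = (e(L^kε), p(L^kε))` (its reading `L^kε ≤ e_Rp_R` by `mesh_le_runCoupling_mul_log`), converted by `ineq25At_smooth116_currency`
with `runCoupling_rpow_mul_log_le`. [cite: Balaban1983Higgs3, (2.5) p.424, (1.16) p.414, p.412] [cite: Balaban1982Higgs1, (3.12), (3.14) p.614] -/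
theorem ineq25At_op116_region_printCurrency (d L : ℕ) (hd : 1 ≤ d) (hL : 2 ≤ L) {a : ℝ} (ha : 0 < a) {msq : ℝ} (hmsq : 0 < msq)
    {c : ℝ} (hc : 0 ≤ c) (N m : ℕ) {c₁ c₂ : ℝ} (hc₁ : 0 ≤ c₁) (hc₂ : 0 ≤ c₂)
    {κ b₀ α' : ℝ} (q : ℕ) (hκ : 0 < κ) (hκ1 : κ ≤ 1) (hb₀ : 0 ≤ b₀) (hα'0 : 0 < α') (hα'1 : α' < 1)
    (n n' : ℕ) (hn : 1 ≤ n) (hn' : 1 ≤ n') (hdn : d < n + n') :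
    ∃ E₀ : ℝ, 0 < E₀ ∧ ∀ (C : ChargeData N), C.e ^ 2 ≤ E₀ →
      ∃ K₀min : ℕ, ∀ {α : ℝ}, 0 ≤ α → α < 1 → ∀ K₀ : ℕ, K₀min ≤ K₀ →
      ∃ t δ₁ δ₀ Cst CM CH CG : ℝ, 0 < t ∧ 0 < δ₁ ∧ δ₁ ≤ 1 ∧ 0 < δ₀ ∧ 0 ≤ Cst ∧ 0 ≤ CM ∧ 0 ≤ CH ∧ 0 ≤ CG ∧
      ∀ (P : HiggsLattice.Params) (hP1 : 1 < P.L), P.d = d → P.L = L → K₀ ∣ P.M →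
      ∀ {k : ℕ}, 1 ≤ k → k ≤ P.K → (∀ μ, 3 * half P k K₀ ≤ P.sitesPerDir 0 μ) → P.mesh k ≤ 1 →
      ∀ (Ω Ω₂ : Finset (HiggsLattice.Site P 0)), IsBigBlockUnion k K₀ Ω → IsBigBlockUnion k K₀ Ω₂ → Ω₂ ⊆ Ω →
      ∀ (A B : HiggsLattice.VecField P 0) {δB δAB δA s : ℝ}, 0 ≤ δB → 0 ≤ δAB → 0 ≤ δA → 0 ≤ s →
        (∀ z ∈ Ω, ∀ μ ν : Fin P.d, |B ⟨z.shift ν, μ⟩ - B ⟨z, μ⟩| ≤ δB) →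
        (∀ z ∈ Ω, ∀ μ ν : Fin P.d, |(A + B) ⟨z.shift ν, μ⟩ - (A + B) ⟨z, μ⟩| ≤ δAB) →
        (∀ (z : HiggsLattice.Site P 0) (μ ν : Fin P.d), |A ⟨z.shift ν, μ⟩ - A ⟨z, μ⟩| ≤ δA) →
        (P.L : ℝ) ^ k * δB * |C.e| ≤ t → (P.L : ℝ) ^ k * δAB * |C.e| ≤ t → (P.L : ℝ) ^ k * δB ≤ c * |C.e| →
        (∀ b : HiggsLattice.PBond P 0, |A b| ≤ s) → P.mesh k * (|C.e| * s) ≤ 1 →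
        (∀ b : HiggsLattice.PBond P 0, A b ≠ 0 → DeepBlk k K₀ Ω b.src ∧ DeepBlk k K₀ Ω b.tgt) →
        1 ≤ |C.e| * b₀ →
      ∀ (r₀ : ℕ), Ix N →
        (sect2Smooth116 hP1 C Ω Ω₂ A B msq a k K₀ r₀ m c₁ c₂ ((|C.e| * P.mesh k ^ κ) ^ (1 - α')) 1).Ineq25At n n' α
          (min δ₀ (δ₁ / (4 * (P.L : ℝ)) ^ (n + n' + 1)))
          ((CG + (smoothConst P.d m c₁ (c₂ + 2 * c₁) *
              (valC P N C k a δ₁ Cst s δA (n + n') + derC P N C k a δ₁ Cst s δA (n + n'))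
            + (holC P N C k a δ₁ Cst s δA α (P.mesh 0 ^ P.d * CH) (n + n' - 1)
              + P.d * m * mixC P N C k a δ₁ Cst CM s δA (n + n'))))
            * (max 1 (|C.e| ^ α' * b₀ * max 1 ((q : ℝ) / (κ * α')) ^ q)) ^ (n + n')) := by
  obtain ⟨E₀, hE₀, hR⟩ := ineq25At_op116_region d L hd hL ha hmsq hc N m hc₁ hc₂ n n' hn hn' hdn
  refine ⟨E₀, hE₀, fun C heC => ?_⟩
  obtain ⟨K₀min, hK⟩ := hR C heC
  refine ⟨K₀min, fun {α} hα0 hα1 K₀ hK₀ => ?_⟩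
  obtain ⟨t, δ₁, δ₀, Cst, CM, CH, CG, ht, hδ₁, hδ₁1, hδ₀, hCst, hCM, hCH, hCG, h⟩ := hK hα0 hα1 K₀ hK₀
  refine ⟨t, δ₁, δ₀, Cst, CM, CH, CG, ht, hδ₁, hδ₁1, hδ₀, hCst, hCM, hCH, hCG, ?_⟩
  intro P hP1 hPd hPL hK₀M k hk hkK h3h hmesh Ω Ω₂ hΩ hΩ₂ hsub A B δB δAB δA s hδB hδAB hδA hs hregB hregAB hregA htB htAB hcB hA ht1
    hAS hb r₀ i₀
  have hδ := P.mesh_pos k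
  -- the printed running constants at δ = L^kε
  set eR : ℝ := |C.e| * P.mesh k ^ κ with heR
  set pR : ℝ := b₀ * (1 + Real.log (P.mesh k)⁻¹) ^ q with hpR
  have hlog : 0 ≤ Real.log (P.mesh k)⁻¹ := by rw [Real.log_inv]; have := Real.log_nonpos hδ.le hmesh; linarith
  have heR0 : 0 ≤ eR := mul_nonneg (abs_nonneg _) (Real.rpow_nonneg hδ.le κ)
  have hpR0 : 0 ≤ pR := mul_nonneg hb₀ (pow_nonneg (by linarith) q)
  have hmle : P.mesh k ≤ eR * pR := mesh_le_runCoupling_mul_log hδ hmesh hκ1 hb q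
  -- R5's member at (e_R, p_R)
  have hmain := h P hP1 hPd hPL hK₀M hk hkK h3h hmesh Ω Ω₂ hΩ hΩ₂ hsub A B hδB hδAB hδA hs hregB hregAB hregA htB htAB hcB hA ht1 hAS r₀
    (mul_nonneg heR0 hpR0) hmle i₀
  -- the conversion
  set K : ℝ := max 1 (|C.e| ^ α' * b₀ * max 1 ((q : ℝ) / (κ * α')) ^ q) with hKdef
  have hK1 : 1 ≤ K := le_max_left _ _
  have hKb : eR ^ α' * pR ≤ K := (runCoupling_rpow_mul_log_le hδ hmesh hκ hα'0 hb₀ q).trans (le_max_right _ _)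
  have hε := P.mesh_pos 0
  have hL1' : 1 < P.L := hP1
  have hL1r : (1 : ℝ) ≤ (P.L : ℝ) := by exact_mod_cast P.hL
  have hdP : P.d < n + n' := by rw [hPd]; exact hdn
  -- the sign of R5's constant
  have hC0 : 0 ≤ CG + (smoothConst P.d m c₁ (c₂ + 2 * c₁) *
        (valC P N C k a δ₁ Cst s δA (n + n') + derC P N C k a δ₁ Cst s δA (n + n'))
      + (holC P N C k a δ₁ Cst s δA α (P.mesh 0 ^ P.d * CH) (n + n' - 1) + P.d * m * mixC P N C k a δ₁ Cst CM s δA (n + n'))) := by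
    have hM : (P.d : ℝ) < ((n + n' : ℕ) : ℝ) := by exact_mod_cast hdP
    have hCV := B3Op116DKernelRegularTorus.valC_nonneg (P := P) (N := N) (C := C) (k := k) (a := a) hL1' hδ₁ hCst hs hδA (n + n')
      (by linarith)
    have hCD := B3Op116DKernelRegularTorus.derC_nonneg (P := P) (N := N) (C := C) (k := k) (a := a) hL1' hδ₁ hCst hs hδA (n + n')
      (by linarith)
    have hCH0 : 0 ≤ P.mesh 0 ^ P.d * CH := mul_nonneg (pow_nonneg hε.le P.d) hCH
    have hdH : (P.d : ℝ) < 1 + ((n + n' - 1 + 1 : ℕ) : ℝ) - α := by rw [show n + n' - 1 + 1 = n + n' by omega]; linarith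
    have hCH' := B3Op116HolderKernelRegularTorus.holC_nonneg (P := P) (N := N) (C := C) (k := k) (a := a)
      (cH := P.mesh 0 ^ P.d * CH) hL1' hδ₁ hCst hs hδA hα1 hCH0 (n + n' - 1) hdH
    have hCM' := B3Op116MixedKernelRegularTorus.mixC_nonneg (P := P) (N := N) (C := C) (k := k) hL1' hδ₁ hCst hCM ha.le hs hδA hdP
    have hKs := B3Ineq31SmoothLocalization.smoothConst_pos P.d m hc₁ (by positivity : 0 ≤ c₂ + 2 * c₁)
    positivity
  exact ineq25At_smooth116_currency hC0 heR0 hpR0 hα'1 hK1 hKb hmain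

/-- **THE TORUS CASE `Ω = T_ε` IN PRINT'S CURRENCY**: every site of the torus is deep (`interior_univ`), so the support clause on `Ã` is void;
the same conclusion for the carrier `sect2Smooth116 hP1 C T_ε Ω₂ …` and every big-block union `Ω₂` (the currency form of p40 g74's
`B3Ineq25Op116Torus.ineq25At_op116_torus`, here obtained from the region member). [cite: Balaban1983Higgs3, (2.5) p.424, (1.16) p.414] [cite: Balaban1982Higgs1, (3.12), (3.14) p.614] -/
theorem ineq25At_op116_torus_printCurrency (d L : ℕ) (hd : 1 ≤ d) (hL : 2 ≤ L) {a : ℝ} (ha : 0 < a) {msq : ℝ} (hmsq : 0 < msq)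
    {c : ℝ} (hc : 0 ≤ c) (N m : ℕ) {c₁ c₂ : ℝ} (hc₁ : 0 ≤ c₁) (hc₂ : 0 ≤ c₂)
    {κ b₀ α' : ℝ} (q : ℕ) (hκ : 0 < κ) (hκ1 : κ ≤ 1) (hb₀ : 0 ≤ b₀) (hα'0 : 0 < α') (hα'1 : α' < 1)
    (n n' : ℕ) (hn : 1 ≤ n) (hn' : 1 ≤ n') (hdn : d < n + n') :
    ∃ E₀ : ℝ, 0 < E₀ ∧ ∀ (C : ChargeData N), C.e ^ 2 ≤ E₀ →
      ∃ K₀min : ℕ, ∀ {α : ℝ}, 0 ≤ α → α < 1 → ∀ K₀ : ℕ, K₀min ≤ K₀ →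
      ∃ t δ₁ δ₀ Cst CM CH CG : ℝ, 0 < t ∧ 0 < δ₁ ∧ δ₁ ≤ 1 ∧ 0 < δ₀ ∧ 0 ≤ Cst ∧ 0 ≤ CM ∧ 0 ≤ CH ∧ 0 ≤ CG ∧
      ∀ (P : HiggsLattice.Params) (hP1 : 1 < P.L), P.d = d → P.L = L → K₀ ∣ P.M →
      ∀ {k : ℕ}, 1 ≤ k → k ≤ P.K → (∀ μ, 3 * half P k K₀ ≤ P.sitesPerDir 0 μ) → P.mesh k ≤ 1 →
      ∀ (Ω₂ : Finset (HiggsLattice.Site P 0)), IsBigBlockUnion k K₀ Ω₂ →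
      ∀ (A B : HiggsLattice.VecField P 0) {δB δAB δA s : ℝ}, 0 ≤ δB → 0 ≤ δAB → 0 ≤ δA → 0 ≤ s →
        (∀ (z : HiggsLattice.Site P 0) (μ ν : Fin P.d), |B ⟨z.shift ν, μ⟩ - B ⟨z, μ⟩| ≤ δB) →
        (∀ (z : HiggsLattice.Site P 0) (μ ν : Fin P.d), |(A + B) ⟨z.shift ν, μ⟩ - (A + B) ⟨z, μ⟩| ≤ δAB) →
        (∀ (z : HiggsLattice.Site P 0) (μ ν : Fin P.d), |A ⟨z.shift ν, μ⟩ - A ⟨z, μ⟩| ≤ δA) →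
        (P.L : ℝ) ^ k * δB * |C.e| ≤ t → (P.L : ℝ) ^ k * δAB * |C.e| ≤ t → (P.L : ℝ) ^ k * δB ≤ c * |C.e| →
        (∀ b : HiggsLattice.PBond P 0, |A b| ≤ s) → P.mesh k * (|C.e| * s) ≤ 1 → 1 ≤ |C.e| * b₀ →
      ∀ (r₀ : ℕ), Ix N →
        (sect2Smooth116 hP1 C Finset.univ Ω₂ A B msq a k K₀ r₀ m c₁ c₂ ((|C.e| * P.mesh k ^ κ) ^ (1 - α')) 1).Ineq25At n n' α
          (min δ₀ (δ₁ / (4 * (P.L : ℝ)) ^ (n + n' + 1)))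
          ((CG + (smoothConst P.d m c₁ (c₂ + 2 * c₁) *
              (valC P N C k a δ₁ Cst s δA (n + n') + derC P N C k a δ₁ Cst s δA (n + n'))
            + (holC P N C k a δ₁ Cst s δA α (P.mesh 0 ^ P.d * CH) (n + n' - 1)
              + P.d * m * mixC P N C k a δ₁ Cst CM s δA (n + n'))))
            * (max 1 (|C.e| ^ α' * b₀ * max 1 ((q : ℝ) / (κ * α')) ^ q)) ^ (n + n')) := by
  obtain ⟨E₀, hE₀, hR⟩ := ineq25At_op116_region_printCurrency d L hd hL ha hmsq hc N m hc₁ hc₂ q hκ hκ1 hb₀ hα'0 hα'1 n n' hn hn' hdn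
  refine ⟨E₀, hE₀, fun C heC => ?_⟩
  obtain ⟨K₀min, hK⟩ := hR C heC
  refine ⟨K₀min, fun {α} hα0 hα1 K₀ hK₀ => ?_⟩
  obtain ⟨t, δ₁, δ₀, Cst, CM, CH, CG, ht, hδ₁, hδ₁1, hδ₀, hCst, hCM, hCH, hCG, h⟩ := hK hα0 hα1 K₀ hK₀
  refine ⟨t, δ₁, δ₀, Cst, CM, CH, CG, ht, hδ₁, hδ₁1, hδ₀, hCst, hCM, hCH, hCG, ?_⟩
  intro P hP1 hPd hPL hK₀M k hk hkK h3h hmesh Ω₂ hΩ₂ A B δB δAB δA s hδB hδAB hδA hs hregB hregAB hregA htB htAB hcB hA ht1 hb r₀ i₀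
  exact h P hP1 hPd hPL hK₀M hk hkK h3h hmesh Finset.univ Ω₂ isBigBlockUnion_univ hΩ₂ (Finset.subset_univ _) A B hδB hδAB hδA hs
    (fun z _ μ ν => hregB z μ ν) (fun z _ μ ν => hregAB z μ ν) hregA htB htAB hcB hA ht1
    (fun b _ => ⟨fun z _ z' _ => interior_univ z', fun z _ z' _ => interior_univ z'⟩) hb r₀ i₀

end Members

end Literature.MathematicalPhysics.QuantumFieldTheory.Balaban1983to89.B3Ineq25Op116PrintCurrency

end
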